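import Mathlib
import Literature.MathematicalPhysics.QuantumLattice.ThinSectorCooperTolerance
import HarnessLib

/-!
# Thin-sector four-leg counting: the FOLD-RANGE TOLERANCE (the level of the fourth leg moves by `O(w·(distance to the forward point) + w·t + w²)`)

Topic `Literature/MathematicalPhysics/QuantumLattice`; namespace `ThinSectorCount` (continues `ThinSectorCooperTolerance`).  File 4b of the
log-free ANISOTROPIC anchored four-sector counting lemma («E1-P2-THIN-COUNT», cell gate-hubbard-kl, plan g17 (R41); owner seat p4; plan
HOME/prover-p4/E1-P2-THIN-COUNT-PLAN.md §Refinement 3).  Setting of `ThinSectorCooperTolerance`: a centrally symmetric `C¹` curve `γ` on the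
level set `{E = μ}` of a differentiable `E` on a real normed space, `h(θ₁, θ₂, θ₃) = E(γθ₁ + γθ₂ + γθ₃) − μ` (inline).  In the FOLD ranges of the
four-leg count (the two summed legs nearly parallel, `θ₃ − θ₂ = t` small) the isotropic tolerance `δ ≍ w` produces the second printed logarithm
(the `(J+1)` dyadic-depth factor of `BandSectorCounting.count_anti_total`; Mastropietro p. 229).  Its thin replacement rests on one estimate, proved
here WITHOUT any case analysis: at every point of the three boxes, all three angular partials of `h` are
`≤ (2HV² + GA)·(|θ₂ − θ₁ − π| + |θ₃ − θ₁ − π|)` — they vanish to first order at the FORWARD configuration `θ₂ = θ₃ = θ₁ + π` (`k₂ = k₃ = −k₁`,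
`k₄ = k₁`), because `E′(γ(θ + π))` kills both `γ′(θ)` and `γ′(θ + π)` (`fderiv_apply_tangent_eq_zero`, `curve_deriv_add_pi`).  Hence

* **`abs_level3_le_of_near_zero_forward`** — near-solution `|h(θ₁′, a′, c′)| ≤ ρ`, centres within `ω`:
  `|h(θ₁, a, c)| ≤ ρ + ω·(3HV² + 2GA)·(|a − θ₁ − π| + |c − θ₁ − π| + 8ω)`;
* **`abs_level3_le_thin_fold`** — sector currency (`ω ≤ w`, `ρ ≤ C_r w²`), anti-diagonal coordinates `a = σ − t/2`, `c = σ + t/2`, `0 ≤ t`: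
  `|h(θ₁, σ − t/2, σ + t/2)| ≤ (C_r + 8K₃)·w² + 2K₃·w·|σ − θ₁ − π| + K₃·w·t`, `K₃ = 3HV² + 2GA` — a per-`σ` tolerance `δ₀ + δ₃·|σ − θ₁ − π|`
  (`δ₀ ≍ w²`, `δ₃ ≍ w`; near the forward point `|σ − θ₁ − π| ≍ √(D(σ)/q)`, the `√`-weighted tolerance of `ThinSectorFoldRange`) plus a `t`-affine
  part `δ₁·t`, `δ₁ ≍ w`, which the fold-in-`t` count absorbs into an `O(1)` widening of each cluster.

* **`abs_level3_le_of_near_zero_fat`** — the isotropic `ρ + 3GVω` (all the transversal range needs).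

Away from the forward point the bound is the isotropic `O(w)` (correctly: at the umklapp corner the anchor's box genuinely tilts the level by
`≍ w·sin φ`, `ThinSectorCornerCluster`).  Pure real analysis; everything is proved; no definitions, no named facts.  Nothing asserts superconductivity.

## Sources

* V. Mastropietro, *Non-Perturbative Renormalization* (World Scientific, 2008), ch. 14, Sector Lemma (14.67), p. 223; p. 229. [Mastropietro2008]
* G. Benfatto, A. Giuliani, V. Mastropietro, Ann. Henri Poincaré 7 (2006) 809–898, (2.89), App. A3 Lemma A3.1. [BenfattoGiulianiMastropietro2006]
* V. Rivasseau, J. Stat. Phys. 106 (2002) 693–722 (arXiv:cond-mat/0107118), Lemma 5 p. 9.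
-/

noncomputable section

namespace Literature.MathematicalPhysics.QuantumLattice.ThinSectorCount

open Real Set

section Fold

variable {F : Type*} [NormedAddCommGroup F] [NormedSpace ℝ F]

/-- Real-valued segment mean-value inequality (private plumbing). [folklore] -/
private theorem abs_sub_le_mul_of_hasDerivAt' {f f' : ℝ → ℝ} {C a b : ℝ} (hf : ∀ t, HasDerivAt f (f' t) t)
    (hC : ∀ t ∈ uIcc a b, |f' t| ≤ C) : |f b - f a| ≤ C * |b - a| := by
  have h := Convex.norm_image_sub_le_of_norm_hasDerivWithin_le (fun t _ => (hf t).hasDerivWithinAt)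
    (fun t ht => by rw [Real.norm_eq_abs]; exact hC t ht) (convex_uIcc a b) left_mem_uIcc right_mem_uIcc
  simpa [Real.norm_eq_abs] using h

variable {E : F → ℝ} {E' : F → F →L[ℝ] ℝ} (hE : ∀ x, HasFDerivAt E (E' x) x)
  {G H : ℝ} (hG : ∀ x, ‖E' x‖ ≤ G) (hH : ∀ x y, ‖E' x - E' y‖ ≤ H * ‖x - y‖) (hH0 : 0 ≤ H)
  {γ γ' : ℝ → F} (hγ : ∀ θ, HasDerivAt γ (γ' θ) θ) {V A : ℝ} (hV : ∀ θ, ‖γ' θ‖ ≤ V)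
  (hA : ∀ s t, ‖γ' s - γ' t‖ ≤ A * |s - t|)
  (hsym : ∀ θ, γ (θ + π) = -γ θ) {μ : ℝ} (hlev : ∀ θ, E (γ θ) = μ)
include hE hG hH hH0 hγ hV hA hsym hlev

/-- **All three partials are small near the forward configuration**: at any `(θ, ξ₂, ξ₃)`, with `S = γθ + γξ₂ + γξ₃` and
`Σ = |ξ₂ − θ − π| + |ξ₃ − θ − π|`: `|E′(S)[γ′θ]| ≤ HV²·Σ` and `|E′(S)[γ′ξᵢ]| ≤ (HV² + GA)·Σ` (`i = 2, 3`).
[cite: BenfattoGiulianiMastropietro2006, App. A3 Lemma A3.1] -/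
theorem abs_partials_le_forward (θ ξ₂ ξ₃ : ℝ) :
    |E' (γ θ + γ ξ₂ + γ ξ₃) (γ' θ)| ≤ H * V ^ 2 * (|ξ₂ - θ - π| + |ξ₃ - θ - π|) ∧
    |E' (γ θ + γ ξ₂ + γ ξ₃) (γ' ξ₂)| ≤ (H * V ^ 2 + G * A) * (|ξ₂ - θ - π| + |ξ₃ - θ - π|) ∧
    |E' (γ θ + γ ξ₂ + γ ξ₃) (γ' ξ₃)| ≤ (H * V ^ 2 + G * A) * (|ξ₂ - θ - π| + |ξ₃ - θ - π|) := by
  have hV0 : 0 ≤ V := (norm_nonneg _).trans (hV 0)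
  have hG0 : 0 ≤ G := (norm_nonneg _).trans (hG 0)
  have hA0 : 0 ≤ A := by
    have h := hA 1 0; rw [sub_zero, abs_one, mul_one] at h; exact (norm_nonneg _).trans h
  set Sg := |ξ₂ - θ - π| + |ξ₃ - θ - π| with hSg
  have hSg0 : 0 ≤ Sg := by positivity
  -- `S − γ(θ + π) = (γξ₂ − γ(θ+π)) + (γξ₃ − γ(θ+π))`
  have hS : ‖γ θ + γ ξ₂ + γ ξ₃ - γ (θ + π)‖ ≤ V * Sg := by
    have e : γ θ + γ ξ₂ + γ ξ₃ - γ (θ + π) = (γ ξ₂ - γ (θ + π)) + (γ ξ₃ - γ (θ + π)) := by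
      rw [hsym θ]; abel
    rw [e, hSg, mul_add]
    refine (norm_add_le _ _).trans (add_le_add ?_ ?_)
    · simpa [sub_sub] using curve_norm_sub_le hγ hV ξ₂ (θ + π)
    · simpa [sub_sub] using curve_norm_sub_le hγ hV ξ₃ (θ + π)
  -- the kernel at `γ(θ + π)` contains `γ′θ` and `γ′(θ + π)`
  have hker : E' (γ (θ + π)) (γ' (θ + π)) = 0 := fderiv_apply_tangent_eq_zero hE hγ hlev _
  have hkerθ : E' (γ (θ + π)) (γ' θ) = 0 := by
    have := curve_deriv_add_pi hγ hsym θ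
    rw [this, map_neg, neg_eq_zero] at hker; exact hker
  have hker' : E' (γ (θ + π)) (γ' (θ + π)) = 0 := fderiv_apply_tangent_eq_zero hE hγ hlev _
  refine ⟨?_, ?_, ?_⟩
  · have h := abs_pairing_sub_le hG hH hH0 (S₀ := γ (θ + π)) (v₀ := γ' θ) hS (hV θ)
      (show ‖γ' θ - γ' θ‖ ≤ 0 by rw [sub_self, norm_zero])
    rw [hkerθ, sub_zero] at h
    calc |E' (γ θ + γ ξ₂ + γ ξ₃) (γ' θ)| ≤ H * (V * Sg) * V + G * 0 := h
      _ = H * V ^ 2 * Sg := by ring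
  · have hv : ‖γ' ξ₂ - γ' (θ + π)‖ ≤ A * Sg := by
      refine (hA _ _).trans (mul_le_mul_of_nonneg_left ?_ hA0)
      rw [hSg, show ξ₂ - (θ + π) = ξ₂ - θ - π by ring]
      linarith [abs_nonneg (ξ₃ - θ - π)]
    have h := abs_pairing_sub_le hG hH hH0 (S₀ := γ (θ + π)) (v₀ := γ' (θ + π)) hS (hV ξ₂) hv
    rw [hker', sub_zero] at h
    calc |E' (γ θ + γ ξ₂ + γ ξ₃) (γ' ξ₂)| ≤ H * (V * Sg) * V + G * (A * Sg) := h
      _ = (H * V ^ 2 + G * A) * Sg := by ring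
  · have hv : ‖γ' ξ₃ - γ' (θ + π)‖ ≤ A * Sg := by
      refine (hA _ _).trans (mul_le_mul_of_nonneg_left ?_ hA0)
      rw [hSg, show ξ₃ - (θ + π) = ξ₃ - θ - π by ring]
      linarith [abs_nonneg (ξ₂ - θ - π)]
    have h := abs_pairing_sub_le hG hH hH0 (S₀ := γ (θ + π)) (v₀ := γ' (θ + π)) hS (hV ξ₃) hv
    rw [hker', sub_zero] at h
    calc |E' (γ θ + γ ξ₂ + γ ξ₃) (γ' ξ₃)| ≤ H * (V * Sg) * V + G * (A * Sg) := h
      _ = (H * V ^ 2 + G * A) * Sg := by ring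

/-- **Thin fold tolerance (abstract form).**  For a near-solution `|h(θ₁′, a′, c′)| ≤ ρ` and centres within `ω` of it,
`|h(θ₁, a, c)| ≤ ρ + ω·(3HV² + 2GA)·(|a − θ₁ − π| + |c − θ₁ − π| + 8ω)` — the three legs' boxes tilt the level only in proportion to the
distance from the forward configuration `a = c = θ₁ + π`. [cite: Mastropietro2008, ch. 14 (14.67)] -/
theorem abs_level3_le_of_near_zero_forward {θ₁ a c θ₁' a' c' ρ ω : ℝ} (hρ : |E (γ θ₁' + γ a' + γ c') - μ| ≤ ρ)
    (h1 : |θ₁ - θ₁'| ≤ ω) (h2 : |a - a'| ≤ ω) (h3 : |c - c'| ≤ ω) :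
    |E (γ θ₁ + γ a + γ c) - μ| ≤
      ρ + ω * (3 * (H * V ^ 2) + 2 * (G * A)) * (|a - θ₁ - π| + |c - θ₁ - π| + 8 * ω) := by
  have hV0 : 0 ≤ V := (norm_nonneg _).trans (hV 0)
  have hG0 : 0 ≤ G := (norm_nonneg _).trans (hG 0)
  have hA0 : 0 ≤ A := by
    have h := hA 1 0; rw [sub_zero, abs_one, mul_one] at h; exact (norm_nonneg _).trans h
  have hω0 : 0 ≤ ω := (abs_nonneg _).trans h1
  have hHV : 0 ≤ H * V ^ 2 := by positivity
  have hGA : 0 ≤ G * A := mul_nonneg hG0 hA0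
  set S₀ := |a - θ₁ - π| + |c - θ₁ - π| with hS₀
  -- in the box, `Σ ≤ S₀ + 8ω`
  have hbox : ∀ θ ξ₂ ξ₃ : ℝ, |θ - θ₁'| ≤ ω → |ξ₂ - a'| ≤ ω → |ξ₃ - c'| ≤ ω →
      |ξ₂ - θ - π| + |ξ₃ - θ - π| ≤ S₀ + 8 * ω := by
    intro θ ξ₂ ξ₃ hθ hξ₂ hξ₃
    have e2 : ξ₂ - θ - π = (ξ₂ - a') - (a - a') + (a - θ₁ - π) + (θ₁ - θ₁') - (θ - θ₁') := by ring
    have e3 : ξ₃ - θ - π = (ξ₃ - c') - (c - c') + (c - θ₁ - π) + (θ₁ - θ₁') - (θ - θ₁') := by ring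
    have b2 : |ξ₂ - θ - π| ≤ |a - θ₁ - π| + 4 * ω := by
      rw [e2]
      have := abs_add_le ((ξ₂ - a') - (a - a') + (a - θ₁ - π) + (θ₁ - θ₁')) (-(θ - θ₁'))
      have := abs_add_le ((ξ₂ - a') - (a - a') + (a - θ₁ - π)) (θ₁ - θ₁')
      have := abs_add_le ((ξ₂ - a') - (a - a')) (a - θ₁ - π)
      have := abs_sub (ξ₂ - a') (a - a')
      rw [abs_neg] at *
      rw [sub_eq_add_neg _ (θ - θ₁')]
      linarith
    have b3 : |ξ₃ - θ - π| ≤ |c - θ₁ - π| + 4 * ω := by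
      rw [e3]
      have := abs_add_le ((ξ₃ - c') - (c - c') + (c - θ₁ - π) + (θ₁ - θ₁')) (-(θ - θ₁'))
      have := abs_add_le ((ξ₃ - c') - (c - c') + (c - θ₁ - π)) (θ₁ - θ₁')
      have := abs_add_le ((ξ₃ - c') - (c - c')) (c - θ₁ - π)
      have := abs_sub (ξ₃ - c') (c - c')
      rw [abs_neg] at *
      rw [sub_eq_add_neg _ (θ - θ₁')]
      linarith
    rw [hS₀]; linarith
  -- move 1: `θ₁′ → θ₁` at `(·, a′, c′)`
  have hM1 : |(E (γ θ₁ + γ a' + γ c') - μ) - (E (γ θ₁' + γ a' + γ c') - μ)| ≤ H * V ^ 2 * (S₀ + 8 * ω) * ω := by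
    have hb : ∀ t ∈ uIcc θ₁' θ₁, |E' (γ t + γ a' + γ c') (γ' t)| ≤ H * V ^ 2 * (S₀ + 8 * ω) := by
      intro t ht
      have ht' : |t - θ₁'| ≤ ω := (abs_sub_left_of_mem_uIcc ht).trans h1
      have := (abs_partials_le_forward hE hG hH hH0 hγ hV hA hsym hlev t a' c').1
      exact this.trans (mul_le_mul_of_nonneg_left (hbox t a' c' ht' (by simp [hω0]) (by simp [hω0])) hHV)
    have := abs_sub_le_mul_of_hasDerivAt' (fun t => hasDerivAt_level3_one hE hγ (μ := μ) t a' c') hb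
    exact this.trans (mul_le_mul_of_nonneg_left h1 (by positivity))
  -- move 2: `a′ → a` at `(θ₁, ·, c′)`
  have hM2 : |(E (γ θ₁ + γ a + γ c') - μ) - (E (γ θ₁ + γ a' + γ c') - μ)| ≤
      (H * V ^ 2 + G * A) * (S₀ + 8 * ω) * ω := by
    have hb : ∀ t ∈ uIcc a' a, |E' (γ θ₁ + γ t + γ c') (γ' t)| ≤ (H * V ^ 2 + G * A) * (S₀ + 8 * ω) := by
      intro t ht
      have ht' : |t - a'| ≤ ω := (abs_sub_left_of_mem_uIcc ht).trans h2
      have := (abs_partials_le_forward hE hG hH hH0 hγ hV hA hsym hlev θ₁ t c').2.1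
      exact this.trans (mul_le_mul_of_nonneg_left (hbox θ₁ t c' h1 ht' (by simp [hω0])) (by positivity))
    have := abs_sub_le_mul_of_hasDerivAt' (fun t => hasDerivAt_level3_two hE hγ (μ := μ) θ₁ t c') hb
    exact this.trans (mul_le_mul_of_nonneg_left h2 (by positivity))
  -- move 3: `c′ → c` at `(θ₁, a, ·)`
  have hM3 : |(E (γ θ₁ + γ a + γ c) - μ) - (E (γ θ₁ + γ a + γ c') - μ)| ≤
      (H * V ^ 2 + G * A) * (S₀ + 8 * ω) * ω := by
    have hb : ∀ t ∈ uIcc c' c, |E' (γ θ₁ + γ a + γ t) (γ' t)| ≤ (H * V ^ 2 + G * A) * (S₀ + 8 * ω) := by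
      intro t ht
      have ht' : |t - c'| ≤ ω := (abs_sub_left_of_mem_uIcc ht).trans h3
      have := (abs_partials_le_forward hE hG hH hH0 hγ hV hA hsym hlev θ₁ a t).2.2
      exact this.trans (mul_le_mul_of_nonneg_left (hbox θ₁ a t h1 h2 ht') (by positivity))
    have := abs_sub_le_mul_of_hasDerivAt' (fun t => hasDerivAt_level3_three hE hγ (μ := μ) θ₁ a t) hb
    exact this.trans (mul_le_mul_of_nonneg_left h3 (by positivity))
  have htri : |E (γ θ₁ + γ a + γ c) - μ| ≤ |E (γ θ₁' + γ a' + γ c') - μ| +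
      |(E (γ θ₁ + γ a' + γ c') - μ) - (E (γ θ₁' + γ a' + γ c') - μ)| +
      |(E (γ θ₁ + γ a + γ c') - μ) - (E (γ θ₁ + γ a' + γ c') - μ)| +
      |(E (γ θ₁ + γ a + γ c) - μ) - (E (γ θ₁ + γ a + γ c') - μ)| := by
    have a1 := abs_sub_abs_le_abs_sub (E (γ θ₁ + γ a' + γ c') - μ) (E (γ θ₁' + γ a' + γ c') - μ)
    have a2 := abs_sub_abs_le_abs_sub (E (γ θ₁ + γ a + γ c') - μ) (E (γ θ₁ + γ a' + γ c') - μ)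
    have a3 := abs_sub_abs_le_abs_sub (E (γ θ₁ + γ a + γ c) - μ) (E (γ θ₁ + γ a + γ c') - μ)
    linarith
  have e : ρ + ω * (3 * (H * V ^ 2) + 2 * (G * A)) * (S₀ + 8 * ω) =
      ρ + H * V ^ 2 * (S₀ + 8 * ω) * ω + (H * V ^ 2 + G * A) * (S₀ + 8 * ω) * ω +
        (H * V ^ 2 + G * A) * (S₀ + 8 * ω) * ω := by ring
  rw [e]; linarith

/-- **Thin fold tolerance (sector currency, anti-diagonal coordinates).**  With `ω ≤ w`, `ρ ≤ C_r·w²`, `0 ≤ t` and centres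
`(θ₁, σ − t/2, σ + t/2)`:  `|h(θ₁, σ − t/2, σ + t/2)| ≤ (C_r + 8K₃)·w² + 2K₃·w·|σ − θ₁ − π| + K₃·w·t`, `K₃ = 3HV² + 2GA`.
[cite: Mastropietro2008, ch. 14 (14.67) p. 223; p. 229] -/
theorem abs_level3_le_thin_fold {θ₁ σ t θ₁' a' c' ρ ω w Cr : ℝ} (hρ : |E (γ θ₁' + γ a' + γ c') - μ| ≤ ρ)
    (hw : 0 < w) (hωw : ω ≤ w) (hCr : ρ ≤ Cr * w ^ 2) (ht : 0 ≤ t)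
    (h1 : |θ₁ - θ₁'| ≤ ω) (h2 : |σ - t / 2 - a'| ≤ ω) (h3 : |σ + t / 2 - c'| ≤ ω) :
    |E (γ θ₁ + γ (σ - t / 2) + γ (σ + t / 2)) - μ| ≤
      (Cr + 8 * (3 * (H * V ^ 2) + 2 * (G * A))) * w ^ 2 + 2 * (3 * (H * V ^ 2) + 2 * (G * A)) * w * |σ - θ₁ - π| +
        (3 * (H * V ^ 2) + 2 * (G * A)) * w * t := by
  have hV0 : 0 ≤ V := (norm_nonneg _).trans (hV 0)
  have hG0 : 0 ≤ G := (norm_nonneg _).trans (hG 0)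
  have hA0 : 0 ≤ A := by
    have h := hA 1 0; rw [sub_zero, abs_one, mul_one] at h; exact (norm_nonneg _).trans h
  have hω0 : 0 ≤ ω := (abs_nonneg _).trans h1
  set K₃ := 3 * (H * V ^ 2) + 2 * (G * A) with hK₃
  have hK₃0 : 0 ≤ K₃ := by positivity
  have hmain := abs_level3_le_of_near_zero_forward hE hG hH hH0 hγ hV hA hsym hlev (a := σ - t / 2) (c := σ + t / 2) hρ h1 h2 h3
  rw [← hK₃] at hmain
  -- `|a − θ₁ − π| + |c − θ₁ − π| ≤ 2|σ − θ₁ − π| + t`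
  have hsum : |σ - t / 2 - θ₁ - π| + |σ + t / 2 - θ₁ - π| ≤ 2 * |σ - θ₁ - π| + t := by
    have e1 : σ - t / 2 - θ₁ - π = (σ - θ₁ - π) - t / 2 := by ring
    have e2 : σ + t / 2 - θ₁ - π = (σ - θ₁ - π) + t / 2 := by ring
    rw [e1, e2]
    have b1 := abs_sub (σ - θ₁ - π) (t / 2)
    have b2 := abs_add_le (σ - θ₁ - π) (t / 2)
    rw [abs_of_nonneg (by linarith : 0 ≤ t / 2)] at b1 b2
    linarith
  have hS0 : 0 ≤ |σ - t / 2 - θ₁ - π| + |σ + t / 2 - θ₁ - π| := by positivity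
  -- assemble: `ρ ≤ C_r w²`, `ω ≤ w`
  have t1 : ω * K₃ * (|σ - t / 2 - θ₁ - π| + |σ + t / 2 - θ₁ - π| + 8 * ω) ≤
      w * K₃ * (2 * |σ - θ₁ - π| + t + 8 * w) := by
    apply mul_le_mul (mul_le_mul_of_nonneg_right hωw hK₃0) (by linarith) (by positivity) (by positivity)
  have e : (Cr + 8 * K₃) * w ^ 2 + 2 * K₃ * w * |σ - θ₁ - π| + K₃ * w * t =
      Cr * w ^ 2 + w * K₃ * (2 * |σ - θ₁ - π| + t + 8 * w) := by ring
  rw [e]; linarith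

omit hH hH0 hA hsym hlev in
/-- **Fat (isotropic) tolerance** — the transversal range needs no more: for a near-solution `|h(θ₁′, a′, c′)| ≤ ρ` and centres within `ω`,
`|h(θ₁, a, c)| ≤ ρ + 3·G·V·ω` (every angular partial is `≤ ‖E′‖·‖γ′‖ ≤ G·V`).  With `ω ≤ w`, `ρ ≤ C_r w²` this is the `δ = C_δ·w` of
`BandSectorCounting.count_transversal`, whose fibre count `2(4δ/(λw) + 1)` is `O(1)` per fibre — no logarithm lives in the transversal range.
[cite: BenfattoGiulianiMastropietro2006, Lemma 3.1] -/
theorem abs_level3_le_of_near_zero_fat {θ₁ a c θ₁' a' c' ρ ω : ℝ} (hρ : |E (γ θ₁' + γ a' + γ c') - μ| ≤ ρ)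
    (h1 : |θ₁ - θ₁'| ≤ ω) (h2 : |a - a'| ≤ ω) (h3 : |c - c'| ≤ ω) :
    |E (γ θ₁ + γ a + γ c) - μ| ≤ ρ + 3 * (G * V) * ω := by
  have hV0 : 0 ≤ V := (norm_nonneg _).trans (hV 0)
  have hG0 : 0 ≤ G := (norm_nonneg _).trans (hG 0)
  have hω0 : 0 ≤ ω := (abs_nonneg _).trans h1
  -- every partial is `≤ G·V`
  have hb : ∀ (S : F) (ξ : ℝ), |E' S (γ' ξ)| ≤ G * V := by
    intro S ξ
    rw [← Real.norm_eq_abs]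
    exact ((E' S).le_opNorm _).trans (mul_le_mul (hG S) (hV ξ) (norm_nonneg _) hG0)
  have hM1 : |(E (γ θ₁ + γ a' + γ c') - μ) - (E (γ θ₁' + γ a' + γ c') - μ)| ≤ G * V * ω :=
    (abs_sub_le_mul_of_hasDerivAt' (fun t => hasDerivAt_level3_one hE hγ (μ := μ) t a' c') (fun t _ => hb _ t)).trans
      (mul_le_mul_of_nonneg_left h1 (by positivity))
  have hM2 : |(E (γ θ₁ + γ a + γ c') - μ) - (E (γ θ₁ + γ a' + γ c') - μ)| ≤ G * V * ω :=
    (abs_sub_le_mul_of_hasDerivAt' (fun t => hasDerivAt_level3_two hE hγ (μ := μ) θ₁ t c') (fun t _ => hb _ t)).trans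
      (mul_le_mul_of_nonneg_left h2 (by positivity))
  have hM3 : |(E (γ θ₁ + γ a + γ c) - μ) - (E (γ θ₁ + γ a + γ c') - μ)| ≤ G * V * ω :=
    (abs_sub_le_mul_of_hasDerivAt' (fun t => hasDerivAt_level3_three hE hγ (μ := μ) θ₁ a t) (fun t _ => hb _ t)).trans
      (mul_le_mul_of_nonneg_left h3 (by positivity))
  have a1 := abs_sub_abs_le_abs_sub (E (γ θ₁ + γ a' + γ c') - μ) (E (γ θ₁' + γ a' + γ c') - μ)
  have a2 := abs_sub_abs_le_abs_sub (E (γ θ₁ + γ a + γ c') - μ) (E (γ θ₁ + γ a' + γ c') - μ)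
  have a3 := abs_sub_abs_le_abs_sub (E (γ θ₁ + γ a + γ c) - μ) (E (γ θ₁ + γ a + γ c') - μ)
  linarith

end Fold

end Literature.MathematicalPhysics.QuantumLattice.ThinSectorCount

end
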